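import Summits.NavierStokesRegularity.NavierStokesRegularity.Theses.RellichScar
import Summits.NavierStokesRegularity.NavierStokesRegularity.Theorems.SymmetricScarExists.Negative.SpiralWorld
import Summits.NavierStokesRegularity.NavierStokesRegularity.Theorems.RellichScarSymmetricScarExistsRdssWallBridge
import Summits.NavierStokesRegularity.NavierStokesRegularity.Theorems.RellichScarSymmetricScarExistsRssPitchFatal
import Summits.NavierStokesRegularity.NavierStokesRegularity.Theorems.FilamentSkeletonRssCoreGluingClassicalOfProfile
import Literature.Analysis.FluidPDE.PineauVicolRDSSLiouvilleHolds
import Literature.Analysis.FluidPDE.TypeIAncientMild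

/-!
# Crux `SymmetricScarExists` (stmt-NavierStokesRegularity-11718), line `rdss-screw-split`: the two
# Pineau–Vicol CORNERS of child C (`RdssApexFatal`), uniform in `𝐈`

Helper file of the line lead (`--supports stmt-NavierStokesRegularity-11718`; theorems only, no definitions, no
named-fact hypotheses).  Child C of the screw split of the crux (`Theorems/RellichScarSymmetricScarExistsSplit.lean`,
glue `symmetricScarExists_of_rdssSplit : A → B → C → S`) is the Type-I rotated-discretely-self-similar Liouville
problem about the `x₃`-axis in APEX-CLASS form: no suitable weak solution on the backward slab with a weak
gradient, `𝐈 < ∞` and the apex bound `‖u‖ ≤ C/(‖x‖ + √(−t))`, singular at the origin, is a.e. fixed on the slab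
by a screw-dilation `u ↦ R_θ D_c u ∘ R_{−θ}` with `c > 1`.  Writing the screw `(c, θ)` as one period of
Pineau–Vicol's rotated discretely self-similar ansatz (arXiv:2607.09619, (1.13a–b)) — period `S = 2 log c` in
`s = −log(−t)` and angular speed `α = θ/(2 log c)` — this file lands the two corners of Pineau–Vicol's
**Theorem 1.7** in the apex class, with thresholds depending on the apex constant `C` ONLY:

* `rdssApexFatal_pineauVicol_slow` (registered auxiliary stub; Thm 1.7 (i)): for every `C > 0` there are
  `α₁ > 0`, `c₁ > 1` such that child C holds for all screws with `1 < c < c₁` and `|θ| ≤ 2α₁ log c`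
  (`|α| ≤ α₁`).
* `rdssApexFatal_pineauVicol_fast` (registered auxiliary stub; Thm 1.7 (ii)): for every `C > 0` there are
  `α₂ > 0`, `c₂ > 1` such that child C holds for all screws with `|θ| ≥ 2α₂ log c` (`|α| ≥ α₂`) and
  `1 < c < c₂^{1/(1+α²)}`.

The transport (template `ScarWindow.rssApexFatal_smallOrLargePitch`, Thm 1.4): the profile is a.e. a Type-I
ancient mild field `V` (`stub_apexMildRepresentative`), classical on `(−∞, 0)` for a smooth pressure
(`exists_isClassicalNSSolutionOn_Iio`); the a.e. screw identity transports to `V` and holds pointwise on the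
open slab by continuity (`conjZ_ae_eq_slab`, `nsRescale_ae_eq_slab`, `Measure.eqOn_open_of_ae_eq`).  The new,
reusable piece of infrastructure is the **periodic profile of a screw-invariant field** (§1):
`U(y, s) = e^{−s/2} R(−αs) V(−e^{−s}, e^{−s/2} R(αs) y)` is jointly smooth (`contDiff_periodicProfile`, via the
tree's `classicalOfProfile_contDiff_rotZ`: rotation with a variable angle is smooth),
`2 log c`-periodic in `s` iff `V` is `(c, θ)`-screw invariant (`periodicProfile_add_period`), and `V` is
Pineau–Vicol's ansatz `pvAnsatz α U` of it (`pvAnsatz_periodicProfile`).  Theorem 1.7 on `[−1, 0)` then gives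
`U ≡ 0` on one period, periodicity on all of `ℝ`, the ansatz `V ≡ 0` on `t < 0`, so `u = 0` a.e. on the slab
and the origin is not singular (`not_isBackwardSingularPoint_of_ae_zero_slab`).

References: B. Pineau, V. Vicol, *On rotated backwards self-similar solutions of the incompressible 3D
Navier–Stokes equations*, arXiv:2607.09619 (2026), (1.13a–b) and Theorem 1.7 p. 7, Conjecture 1.1
[PineauVicol2026]; D. Chae, J. Wolf, Comm. PDE 42 (2017) = arXiv:1610.09464, Thm 1.3 [ChaeWolf2017RemovingDSS];
Z. Bradshaw, T.-P. Tsai, Comm. PDE 42 (2017) = arXiv:1610.05680, §5 OP 5.1 [BradshawTsai2017CPDE]; G. Koch,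
N. Nadirashvili, G. Seregin, V. Šverák, Acta Math. 203 (2009), Lemma 3.1, Prop. 4.1 [KNSS2009].
-/

noncomputable section

open MeasureTheory Set Function Filter Topology TopologicalSpace Metric
open scoped NNReal ENNReal

namespace Summit.NavierStokesRegularity.NavierStokesRegularity.Theorems.SymmetricScarExists.RdssSplit.PineauVicol

open Literature.Analysis.FluidPDE
open Summit.NavierStokesRegularity.NavierStokesRegularity.Theses.RellichScar
open Summit.NavierStokesRegularity.NavierStokesRegularity.Theorems.SymmetricScarExists.Negative
open Summit.NavierStokesRegularity.NavierStokesRegularity.Theorems.SymmetricScarExists.ScarWindow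
open Summit.NavierStokesRegularity.NavierStokesRegularity.Theorems.RellichScarScarRigidity
  (stub_apexMildRepresentative exists_isClassicalNSSolutionOn_Iio)

set_option linter.dupNamespace false

/-! ## §1 The periodic profile of a screw-invariant field -/

/-- **Joint smoothness of the periodic profile.**  If `V` is jointly `C^∞` on the open slab `t < 0`, then
`(y, s) ↦ e^{−s/2} R(−αs) V(−e^{−s}, e^{−s/2} R(αs) y)` is jointly `C^∞` on `ℝ³ × ℝ`: the inner point
`(−e^{−s}, e^{−s/2} R(αs) y)` ranges smoothly in the open slab. [folklore] -/
theorem contDiff_periodicProfile {α : ℝ} {V : ℝ → EuclideanSpace ℝ (Fin 3) → EuclideanSpace ℝ (Fin 3)}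
    (hV : ContDiffOn ℝ (⊤ : ℕ∞) (uncurry V) (Iio (0 : ℝ) ×ˢ (univ : Set (EuclideanSpace ℝ (Fin 3))))) :
    ContDiff ℝ (⊤ : ℕ∞) (fun q : EuclideanSpace ℝ (Fin 3) × ℝ =>
      Real.exp (-q.2 / 2) • rotZ (-(α * q.2))
        (V (-Real.exp (-q.2)) (Real.exp (-q.2 / 2) • rotZ (α * q.2) q.1))) := by
  have hE : ContDiff ℝ (⊤ : ℕ∞) (fun q : EuclideanSpace ℝ (Fin 3) × ℝ => Real.exp (-q.2 / 2)) :=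
    Real.contDiff_exp.comp (contDiff_snd.neg.div_const 2)
  have hθ : ContDiff ℝ (⊤ : ℕ∞) (fun q : EuclideanSpace ℝ (Fin 3) × ℝ => α * q.2) :=
    contDiff_const.mul contDiff_snd
  have hT : ContDiff ℝ (⊤ : ℕ∞) (fun q : EuclideanSpace ℝ (Fin 3) × ℝ => -Real.exp (-q.2)) :=
    (Real.contDiff_exp.comp contDiff_snd.neg).neg
  have hin : ContDiff ℝ (⊤ : ℕ∞) (fun q : EuclideanSpace ℝ (Fin 3) × ℝ =>
      Real.exp (-q.2 / 2) • rotZ (α * q.2) q.1) :=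
    hE.smul (classicalOfProfile_contDiff_rotZ hθ contDiff_fst)
  have hVc : ContDiff ℝ (⊤ : ℕ∞) (fun q : EuclideanSpace ℝ (Fin 3) × ℝ =>
      V (-Real.exp (-q.2)) (Real.exp (-q.2 / 2) • rotZ (α * q.2) q.1)) :=
    hV.comp_contDiff (hT.prodMk hin) fun q => mk_mem_prod (neg_neg_of_pos (Real.exp_pos _)) (mem_univ _)
  exact hE.smul (classicalOfProfile_contDiff_rotZ hθ.neg hVc)

/-- **A screw-invariant field has a periodic profile.**  If `R_θ (c V(c²t, c R_{−θ} x)) = V(t, x)` for all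
`t < 0`, `x` (`c > 1`), then with `α = θ/(2 log c)` the profile
`U(y, s) = e^{−s/2} R(−αs) V(−e^{−s}, e^{−s/2} R(αs) y)` is `2 log c`-periodic in `s`: one period is
exactly one application of the screw at time `−e^{−s}/c²`. [cite: PineauVicol2026, (1.13a)–(1.13b) (arXiv:2607.09619 p. 7)] -/
theorem periodicProfile_add_period {c θ : ℝ} {V : ℝ → EuclideanSpace ℝ (Fin 3) → EuclideanSpace ℝ (Fin 3)}
    (hc : 1 < c) (h : ∀ t : ℝ, t < 0 → ∀ x : EuclideanSpace ℝ (Fin 3), conjZ θ (nsRescale c V) t x = V t x)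
    (y : EuclideanSpace ℝ (Fin 3)) (s : ℝ) :
    Real.exp (-(s + 2 * Real.log c) / 2) • rotZ (-(θ / (2 * Real.log c) * (s + 2 * Real.log c)))
        (V (-Real.exp (-(s + 2 * Real.log c)))
          (Real.exp (-(s + 2 * Real.log c) / 2) • rotZ (θ / (2 * Real.log c) * (s + 2 * Real.log c)) y)) =
      Real.exp (-s / 2) • rotZ (-(θ / (2 * Real.log c) * s))
        (V (-Real.exp (-s)) (Real.exp (-s / 2) • rotZ (θ / (2 * Real.log c) * s) y)) := by
  have hc0 : 0 < c := one_pos.trans hc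
  have hlog : 0 < Real.log c := Real.log_pos hc
  have hne : 2 * Real.log c ≠ 0 := by positivity
  -- the three scalar identities of one period
  have e1 : Real.exp (-(s + 2 * Real.log c) / 2) = Real.exp (-s / 2) * c⁻¹ := by
    rw [show -(s + 2 * Real.log c) / 2 = -s / 2 + -Real.log c by ring, Real.exp_add, Real.exp_neg,
      Real.exp_log hc0]
  have e2 : Real.exp (-(s + 2 * Real.log c)) = Real.exp (-s) * (c ^ 2)⁻¹ := by
    rw [show -(s + 2 * Real.log c) = -s + -(Real.log c + Real.log c) by ring, Real.exp_add,
      Real.exp_neg (Real.log c + Real.log c), Real.exp_add, Real.exp_log hc0, sq]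
  have e3 : θ / (2 * Real.log c) * (s + 2 * Real.log c) = θ / (2 * Real.log c) * s + θ := by
    rw [mul_add, div_mul_cancel₀ θ hne]
  rw [e1, e2, e3]
  -- the screw at time `-e^{-s}/c²` and the point `(e^{-s/2}/c) R(αs + θ) y`
  have hτ : -(Real.exp (-s) * (c ^ 2)⁻¹) < 0 := neg_neg_of_pos (by positivity)
  have key := h _ hτ ((Real.exp (-s / 2) * c⁻¹) • rotZ (θ / (2 * Real.log c) * s + θ) y)
  simp only [conjZ, nsRescale_apply] at key
  have hA : c ^ 2 * -(Real.exp (-s) * (c ^ 2)⁻¹) = -Real.exp (-s) := by field_simp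
  have hB : c * (Real.exp (-s / 2) * c⁻¹) = Real.exp (-s / 2) := by field_simp
  have hB' : Real.exp (-s / 2) * c⁻¹ * c = Real.exp (-s / 2) := by field_simp
  have hC : -θ + (θ / (2 * Real.log c) * s + θ) = θ / (2 * Real.log c) * s := by ring
  have hD : -(θ / (2 * Real.log c) * s + θ) + θ = -(θ / (2 * Real.log c) * s) := by ring
  rw [← key]
  simp only [rotZ_smul', smul_smul, ← rotZ_add]
  rw [hA, hB, hB', hC, hD]

/-- **Every field on `t < 0` is Pineau–Vicol's ansatz of its profile**: with `s = −log(−t)`,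
`V(t, x) = (−t)^{−1/2} R(αs) U(R(−αs) x/√(−t), s)` for `U(y, s) = e^{−s/2} R(−αs) V(−e^{−s}, e^{−s/2} R(αs) y)`
(pure algebra: `e^{−s} = −t`, `e^{−s/2} = √(−t)`). [cite: PineauVicol2026, (1.13a) (arXiv:2607.09619 p. 7)] -/
theorem pvAnsatz_periodicProfile (α : ℝ) (V : ℝ → EuclideanSpace ℝ (Fin 3) → EuclideanSpace ℝ (Fin 3))
    {t : ℝ} (ht : t < 0) (x : EuclideanSpace ℝ (Fin 3)) :
    pvAnsatz α (fun y s => Real.exp (-s / 2) • rotZ (-(α * s))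
        (V (-Real.exp (-s)) (Real.exp (-s / 2) • rotZ (α * s) y))) t x = V t x := by
  have hnt : 0 < -t := neg_pos.2 ht
  have hsq : 0 < Real.sqrt (-t) := Real.sqrt_pos.2 hnt
  have h1 : Real.exp (-(-Real.log (-t)) / 2) = Real.sqrt (-t) := by
    rw [neg_neg, Real.exp_half, Real.exp_log hnt]
  have h2 : -Real.exp (-(-Real.log (-t))) = t := by
    rw [neg_neg, Real.exp_log hnt, neg_neg]
  simp only [pvAnsatz]
  rw [h1, h2, ← rotZ_add, add_neg_cancel, rotZ_zero, smul_smul, mul_inv_cancel₀ hsq.ne', one_smul,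
    rotZ_smul', ← rotZ_add, add_neg_cancel, rotZ_zero, smul_smul, inv_mul_cancel₀ hsq.ne', one_smul]

/-- **The periodic-profile dictionary** (Pineau–Vicol (1.13a–b) read backwards): a field `V`, jointly smooth on
the open slab and pointwise invariant under the screw `(c, θ)`, `c > 1`, is the rotated discretely self-similar
ansatz `pvAnsatz α U` with speed `α = θ/(2 log c)` of a jointly `C^∞`, `2 log c`-periodic profile `U`.
[cite: PineauVicol2026, (1.13a)–(1.13b) (arXiv:2607.09619 p. 7)] -/
theorem exists_periodicProfile_of_screwInvariant {c θ : ℝ}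
    {V : ℝ → EuclideanSpace ℝ (Fin 3) → EuclideanSpace ℝ (Fin 3)} (hc : 1 < c)
    (hV : ContDiffOn ℝ (⊤ : ℕ∞) (uncurry V) (Iio (0 : ℝ) ×ˢ (univ : Set (EuclideanSpace ℝ (Fin 3)))))
    (h : ∀ t : ℝ, t < 0 → ∀ x : EuclideanSpace ℝ (Fin 3), conjZ θ (nsRescale c V) t x = V t x) :
    ∃ U : EuclideanSpace ℝ (Fin 3) → ℝ → EuclideanSpace ℝ (Fin 3),
      ContDiff ℝ (⊤ : ℕ∞) (fun q : EuclideanSpace ℝ (Fin 3) × ℝ => U q.1 q.2) ∧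
      (∀ (y : EuclideanSpace ℝ (Fin 3)) (s : ℝ), U y (s + 2 * Real.log c) = U y s) ∧
      ∀ t : ℝ, t < 0 → ∀ x : EuclideanSpace ℝ (Fin 3), V t x = pvAnsatz (θ / (2 * Real.log c)) U t x :=
  ⟨fun y s => Real.exp (-s / 2) • rotZ (-(θ / (2 * Real.log c) * s))
      (V (-Real.exp (-s)) (Real.exp (-s / 2) • rotZ (θ / (2 * Real.log c) * s) y)),
    contDiff_periodicProfile hV, periodicProfile_add_period hc h,
    fun _ ht x => (pvAnsatz_periodicProfile _ V ht x).symm⟩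

/-! ## §2 The transport to the apex class -/

/-- **Transport of an RDSS Liouville statement at one screw to the apex class.**  Fix `C > 0` and a screw
`(c, θ)`, `c > 1`, and suppose Pineau–Vicol's conclusion holds at speed `α = θ/(2 log c)` and factor `c`:
every classical solution on `[−1, 0)` with the Type-I bound of constant `C` which is the ansatz `pvAnsatz α U`
of a `C²`, `2 log c`-periodic profile has `U ≡ 0` on one period.  Then no suitable weak solution on the slab
with a weak gradient, `𝐈 < ∞` and the apex bound of constant `C`, singular at the origin, is a.e. fixed by the
screw. [cite: PineauVicol2026, Theorem 1.7 (arXiv:2607.09619 p. 7)] -/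
theorem rdssApexFatal_of_liouvilleAt {C c θ : ℝ} (hC : 0 < C) (hc : 1 < c)
    (hL : ∀ (v : ℝ → EuclideanSpace ℝ (Fin 3) → EuclideanSpace ℝ (Fin 3)) (q : ℝ → EuclideanSpace ℝ (Fin 3) → ℝ)
        (U : EuclideanSpace ℝ (Fin 3) → ℝ → EuclideanSpace ℝ (Fin 3)),
      IsClassicalNSSolutionOn (Ico (-1) 0) 1 0 v q →
      (∀ t ∈ Ico (-1 : ℝ) 0, ∀ x : EuclideanSpace ℝ (Fin 3), ‖v t x‖ ≤ C / (‖x‖ + Real.sqrt (-t))) →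
      ContDiff ℝ 2 (fun z : EuclideanSpace ℝ (Fin 3) × ℝ => U z.1 z.2) →
      (∀ (y : EuclideanSpace ℝ (Fin 3)) (s : ℝ), U y (s + 2 * Real.log c) = U y s) →
      (∀ t ∈ Ico (-1 : ℝ) 0, ∀ x : EuclideanSpace ℝ (Fin 3), v t x = pvAnsatz (θ / (2 * Real.log c)) U t x) →
      ∀ (y : EuclideanSpace ℝ (Fin 3)), ∀ s ∈ Icc (0 : ℝ) (2 * Real.log c), U y s = 0)
    {u : ℝ → EuclideanSpace ℝ (Fin 3) → EuclideanSpace ℝ (Fin 3)} {p : ℝ → EuclideanSpace ℝ (Fin 3) → ℝ}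
    {G : ℝ → EuclideanSpace ℝ (Fin 3) → EuclideanSpace ℝ (Fin 3) →L[ℝ] EuclideanSpace ℝ (Fin 3)}
    (hsw : IsSuitableWeakSolutionOn (slab (EuclideanSpace ℝ (Fin 3)) (Iio 0) isOpen_Iio) 1 0 u p)
    (hwg : HasWeakSpatialGradientOn (slab (EuclideanSpace ℝ (Fin 3)) (Iio 0) isOpen_Iio) u G)
    (hI : typeIBound (Iio (0 : ℝ) ×ˢ univ) u p G < ⊤) (hdec : HasTypeIDecay C u)
    (hsing : IsBackwardSingularPoint u 0)
    (hrdss : uncurry (fun t x => rotZ θ (nsRescale c u t (rotZ (-θ) x)))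
      =ᵐ[volume.restrict (Iio (0 : ℝ) ×ˢ univ)] uncurry u) : False := by
  have hc0 : 0 < c := one_pos.trans hc
  have hlog : 0 < Real.log c := Real.log_pos hc
  -- the Type-I ancient mild representative and a classical pressure
  obtain ⟨V, hae, hmild, hdecV⟩ := stub_apexMildRepresentative u p G C hC hsw hwg hI hdec
  obtain ⟨Q, hcl⟩ := exists_isClassicalNSSolutionOn_Iio hmild
  have hcontV : ContinuousOn (uncurry V) (Iio (0 : ℝ) ×ˢ (univ : Set (EuclideanSpace ℝ (Fin 3)))) :=
    hmild.continuousOn_uncurry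
  -- the a.e. screw identity transports to `V` and holds pointwise on the open slab
  have hrdss' : uncurry (conjZ θ (nsRescale c u))
      =ᵐ[volume.restrict (Iio (0 : ℝ) ×ˢ (univ : Set (EuclideanSpace ℝ (Fin 3))))] uncurry u := hrdss
  have haeV : uncurry (conjZ θ (nsRescale c V))
      =ᵐ[volume.restrict (Iio (0 : ℝ) ×ˢ (univ : Set (EuclideanSpace ℝ (Fin 3))))] uncurry V :=
    ((conjZ_ae_eq_slab θ (nsRescale_ae_eq_slab hc0 hae)).trans hrdss').trans hae.symm
  have heqOn : EqOn (uncurry (conjZ θ (nsRescale c V))) (uncurry V)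
      (Iio (0 : ℝ) ×ˢ (univ : Set (EuclideanSpace ℝ (Fin 3)))) :=
    Measure.eqOn_open_of_ae_eq haeV (isOpen_Iio.prod isOpen_univ)
      (continuousOn_uncurry_conjZ θ (continuousOn_uncurry_nsRescale hc0 hcontV)) hcontV
  have hVrdss : ∀ t : ℝ, t < 0 → ∀ x : EuclideanSpace ℝ (Fin 3), conjZ θ (nsRescale c V) t x = V t x :=
    fun t ht x => heqOn (mk_mem_prod ht (mem_univ x))
  -- `V` is the RDSS ansatz of a smooth periodic profile
  obtain ⟨U, hUs, hUper, hans⟩ := exists_periodicProfile_of_screwInvariant hc hmild.contDiffOn hVrdss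
  have hU2 : ContDiff ℝ 2 (fun z : EuclideanSpace ℝ (Fin 3) × ℝ => U z.1 z.2) := hUs.of_le (by norm_cast)
  -- Theorem 1.7 on `[−1, 0)`
  have hcl' : IsClassicalNSSolutionOn (Ico (-1 : ℝ) 0) 1 0 V Q :=
    hcl.mono Ico_subset_Iio_self (uniqueDiffOn_Ico (-1) 0)
  have hI' : ∀ t ∈ Ico (-1 : ℝ) 0, ∀ x : EuclideanSpace ℝ (Fin 3), ‖V t x‖ ≤ C / (‖x‖ + Real.sqrt (-t)) :=
    fun t ht x => hdecV t ht.2 x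
  have hper : ∀ y, ∀ s ∈ Icc (0 : ℝ) (2 * Real.log c), U y s = 0 :=
    hL V Q U hcl' hI' hU2 hUper fun t ht x => hans t ht.2 x
  -- one period is every period
  have hU0 : ∀ (y : EuclideanSpace ℝ (Fin 3)) (s : ℝ), U y s = 0 := by
    intro y s
    have hp : Periodic (fun s => U y s) (2 * Real.log c) := fun s => hUper y s
    obtain ⟨s', hs', he⟩ := hp.exists_mem_Ico₀ (by positivity) s
    have he' : U y s = U y s' := he
    rw [he']
    exact hper y s' (Ico_subset_Icc_self hs')
  -- hence `V ≡ 0` on `t < 0`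
  have hzero : ∀ t : ℝ, t < 0 → ∀ x : EuclideanSpace ℝ (Fin 3), V t x = 0 := by
    intro t ht x
    rw [hans t ht x]
    simp only [pvAnsatz, hU0, rotZ_zero_vec', smul_zero]
  -- so `u = 0` a.e. on the slab, and the origin is not singular
  refine not_isBackwardSingularPoint_of_ae_zero_slab (u := u) ?_ hsing
  filter_upwards [hae, ae_restrict_mem (measurableSet_Iio.prod MeasurableSet.univ)] with w hw hmem
  rw [← hw]
  exact hzero w.1 hmem.1 w.2

/-! ## §3 The two corners of Theorem 1.7 in the apex class -/

/-- **No slowly spinning near-identity screw-invariant singular apex profile, uniformly in `𝐈`** (registered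
auxiliary stub `rdssApexFatal_pineauVicol_slow` of crux stmt-NavierStokesRegularity-11718, line rdss-screw-split;
Pineau–Vicol 2026 Thm 1.7 (i) in the apex class).  For every `C > 0` there are `α₁ > 0`, `c₁ > 1` such that for
`1 < c < c₁` and `|θ| ≤ 2α₁ log c` no suitable weak solution on the slab with a weak gradient, `𝐈 < ∞` and the
apex bound `‖u‖ ≤ C/(‖x‖ + √(−t))`, singular at the origin, satisfies `R_θ (c u(c²t, c R_{−θ} x)) = u(t, x)` a.e.
on the slab. [cite: PineauVicol2026, Theorem 1.7 (arXiv:2607.09619 p. 7)] -/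
theorem rdssApexFatal_pineauVicol_slow :
    ∀ C : ℝ, 0 < C → ∃ α₁ c₁ : ℝ, 0 < α₁ ∧ 1 < c₁ ∧ ∀ (c θ : ℝ), 1 < c → c < c₁ → |θ| ≤ 2 * α₁ * Real.log c → ∀ (u : ℝ → EuclideanSpace ℝ (Fin 3) → EuclideanSpace ℝ (Fin 3)) (p : ℝ → EuclideanSpace ℝ (Fin 3) → ℝ) (G : ℝ → EuclideanSpace ℝ (Fin 3) → EuclideanSpace ℝ (Fin 3) →L[ℝ] EuclideanSpace ℝ (Fin 3)), IsSuitableWeakSolutionOn (slab (EuclideanSpace ℝ (Fin 3)) (Iio 0) isOpen_Iio) 1 0 u p → HasWeakSpatialGradientOn (slab (EuclideanSpace ℝ (Fin 3)) (Iio 0) isOpen_Iio) u G → typeIBound (Iio (0 : ℝ) ×ˢ univ) u p G < ⊤ → HasTypeIDecay C u → IsBackwardSingularPoint u 0 → uncurry (fun t x => rotZ θ (nsRescale c u t (rotZ (-θ) x))) =ᵐ[volume.restrict (Iio (0 : ℝ) ×ˢ univ)] uncurry u → False := by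
  intro C hC
  obtain ⟨⟨α₁, c₁, hα₁, hc₁, H⟩, -⟩ := pineauVicol2026_rdss_liouville_holds C hC
  refine ⟨α₁, c₁, hα₁, hc₁, fun c θ hc hcc hθ u p G hsw hwg hI hdec hsing hrdss => ?_⟩
  have hlog : 0 < Real.log c := Real.log_pos hc
  have hα : |θ / (2 * Real.log c)| ≤ α₁ := by
    rw [abs_div, abs_of_pos (by positivity : (0 : ℝ) < 2 * Real.log c), div_le_iff₀ (by positivity)]
    linarith
  exact rdssApexFatal_of_liouvilleAt hC hc (fun v q U => H _ c v q U hα hc hcc) hsw hwg hI hdec hsing hrdss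

/-- **No fast spinning screw-invariant singular apex profile with factor below `c₂^{1/(1+α²)}`, uniformly in
`𝐈`** (registered auxiliary stub `rdssApexFatal_pineauVicol_fast` of crux stmt-NavierStokesRegularity-11718, line
rdss-screw-split; Pineau–Vicol 2026 Thm 1.7 (ii) in the apex class).  For every `C > 0` there are `α₂ > 0`,
`c₂ > 1` such that for `|θ| ≥ 2α₂ log c` and `1 < c < c₂^{1/(1+α²)}`, `α = θ/(2 log c)`, no suitable weak
solution on the slab with a weak gradient, `𝐈 < ∞` and the apex bound `‖u‖ ≤ C/(‖x‖ + √(−t))`, singular at the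
origin, satisfies `R_θ (c u(c²t, c R_{−θ} x)) = u(t, x)` a.e. on the slab.
[cite: PineauVicol2026, Theorem 1.7 (arXiv:2607.09619 p. 7)] -/
theorem rdssApexFatal_pineauVicol_fast :
    ∀ C : ℝ, 0 < C → ∃ α₂ c₂ : ℝ, 0 < α₂ ∧ 1 < c₂ ∧ ∀ (c θ : ℝ), 1 < c → 2 * α₂ * Real.log c ≤ |θ| → c < c₂ ^ (1 / (1 + (θ / (2 * Real.log c)) ^ 2)) → ∀ (u : ℝ → EuclideanSpace ℝ (Fin 3) → EuclideanSpace ℝ (Fin 3)) (p : ℝ → EuclideanSpace ℝ (Fin 3) → ℝ) (G : ℝ → EuclideanSpace ℝ (Fin 3) → EuclideanSpace ℝ (Fin 3) →L[ℝ] EuclideanSpace ℝ (Fin 3)), IsSuitableWeakSolutionOn (slab (EuclideanSpace ℝ (Fin 3)) (Iio 0) isOpen_Iio) 1 0 u p → HasWeakSpatialGradientOn (slab (EuclideanSpace ℝ (Fin 3)) (Iio 0) isOpen_Iio) u G → typeIBound (Iio (0 : ℝ) ×ˢ univ) u p G < ⊤ → HasTypeIDecay C u → IsBackwardSingularPoint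 u 0 → uncurry (fun t x => rotZ θ (nsRescale c u t (rotZ (-θ) x))) =ᵐ[volume.restrict (Iio (0 : ℝ) ×ˢ univ)] uncurry u → False := by
  intro C hC
  obtain ⟨-, ⟨α₂, c₂, hα₂, hc₂, H⟩⟩ := pineauVicol2026_rdss_liouville_holds C hC
  refine ⟨α₂, c₂, hα₂, hc₂, fun c θ hc hθ hcc u p G hsw hwg hI hdec hsing hrdss => ?_⟩
  have hlog : 0 < Real.log c := Real.log_pos hc
  have hα : α₂ ≤ |θ / (2 * Real.log c)| := by
    rw [abs_div, abs_of_pos (by positivity : (0 : ℝ) < 2 * Real.log c), le_div_iff₀ (by positivity)]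
    linarith
  exact rdssApexFatal_of_liouvilleAt hC hc (fun v q U => H _ c v q U hα hc hcc) hsw hwg hI hdec hsing hrdss

end Summit.NavierStokesRegularity.NavierStokesRegularity.Theorems.SymmetricScarExists.RdssSplit.PineauVicol

end
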